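import Mathlib
import Summits.Ventures.HodgeRepro.Tier4.Common.CongruenceAdeles
import Summits.Ventures.HodgeRepro.Tier4.Common.CompactOpenLevel
import Summits.Ventures.HodgeRepro.Tier4.Common.AdelicPlaces

/-!
# Tier4/Line4/LevelIndexUniform — P3 of (F): the index `[K(N) : K(N·D)]` is bounded uniformly in the level `N`
(`K(N)` covered by at most `M(D)` translates of `K(N·D)`), and the same on every subgroup `H ⊓ K(N)`

Blind re-derivation cell `pub-hodge-repro`, Tier 4 «prove the step» (README §9–§10), seat t4-L4-p2 (prover, LINE L4,
gen 5; piece P3 of the folded ratio (F), plan-4 g5 S15514 / S15533 (2), typer-1 g3 S15673, statement S15706).  Tree path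
`lean/Summits/Ventures/HodgeRepro/Tier4/Line4/LevelIndexUniform.lean`.  Mathlib-level; no literature.  Imports typer-2's
`Common/CongruenceAdeles` (`natSize`, `modSet`, `integralSet`, `isOpen_modSet`, `isCompact_integralSet`),
`Common/CompactOpenLevel` (`IsCongr`, `levelK`, `mem_levelK`, `finPart`, `mem_integralBox_of_isCongr`) and
`Common/AdelicPlaces`.

THE STATEMENT.  For the principal congruence subgroups `K(N) ≤ G(𝔸_f)` (`g ≡ 1`, `g⁻¹ ≡ 1 (mod N)`) and a modulus
`D ≠ 0`: there is `M = M(D)` such that for EVERY level `N ≠ 0`, `K(N)` is covered by at most `M` left translates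
`g K(N D)`, `g ∈ K(N)` (`exists_finset_cover_levelK_mul`); hence for every subgroup `H` (the torus `T`, say: `T_f ∩ K(N)`
since `K(N) ≤ G(𝔸_f)`) `H ⊓ K(N)` is covered by at most `M` translates `h (H ⊓ K(N D))`, `h ∈ H ⊓ K(N)`
(`exists_finset_cover_inf_levelK_mul`), and the relative index `[H ⊓ K(N) : H ⊓ K(N D)] ≤ M` (`relIndex_inf_levelK_mul_le`).
The line's instance is `N = q^{n − c₀}`, `D = q^{c₀}`: `[T_f ∩ K(q^{n−c₀}) : T_f ∩ K(q^n)] ≤ M(c₀)` uniformly in `n`.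

THE PROOF (the cover method of LevelIndexBound, with a scaling trick).  For `g ∈ K(N)` the finite-adelic matrix
`scaled N g := N⁻¹ · finPart (g − 1)` is INTEGRAL entrywise (`|N⁻¹ x|_v = |x|_v / |N|_v ≤ 1`).  The integral box
`∏_{ij} ∏_v 𝓞_v` is compact (Tychonoff) and the classes `Y + U_D`, `U_D = {X | ∀ i j, X i j ∈ modSet D}` (open, an
additive subgroup), cover it: a finite subcover `t` (`IsCompact.elim_nhds_subcover`), `M := #t`, does not depend on `N`.
For each class meeting `{scaled N g | g ∈ K(N)}` pick a `g_Y ∈ K(N)` in it.  If `scaled N g` and `scaled N g′` lie in the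
same class then `finPart (g′ − g) ∈ modSet (N D)` entrywise (multiply back by `N`: `natSize_mul`), and
`g⁻¹ g′ − 1 = g⁻¹ (g′ − g)` with `g⁻¹` integral (`mem_integralBox_of_isCongr`) is `≡ 0 (mod N D)` entrywise with
archimedean part `0` — likewise `g′⁻¹ g`; so `g⁻¹ g′ ∈ K(N D)`, i.e. `g′ ∈ g_Y K(N D)`.  On `H`: a coset `g K(N D)` meeting
`H ⊓ K(N)` at `h` satisfies `g K(N D) ∩ H ⊆ h (H ⊓ K(N D))`.  The index: the representatives surject onto the quotient.

Nothing here says anything about the status of the Hodge conjecture for CM abelian varieties, which is NOT proved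
(HC_CM is NOT proved by anyone in this repository).
-/

set_option autoImplicit false

noncomputable section

namespace Summit.Ventures.HodgeRepro.Tier4.Line4

open Summit.Ventures.HodgeRepro.Tier4.Common NumberField IsDedekindDomain Topology

open scoped Pointwise

/-! ## 1. Valuations: scaling by `N⁻¹` -/

section Valuation

variable {k : Type} [Field k] [NumberField k]

/-- `|N⁻¹|_v = |N|_v⁻¹`. -/
theorem valued_algebraMap_natInv (v : HeightOneSpectrum (𝓞 k)) (N : ℕ) :
    Valued.v (algebraMap k (v.adicCompletion k) ((N : k)⁻¹)) = (natSize k v N)⁻¹ := by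
  rw [map_inv₀ (algebraMap k (v.adicCompletion k)),
    map_inv₀ (Valued.v : Valuation (v.adicCompletion k) (WithZero (Multiplicative ℤ)))]
  rfl

/-- The `v`-component of the finite part of a principal adele is the element in `k_v`. -/
theorem finPart_algebraMap_apply (v : HeightOneSpectrum (𝓞 k)) (x : k) :
    (finPart k (algebraMap k (Ad k) x)) v = algebraMap k (v.adicCompletion k) x := rfl

/-- The `v`-component of a product of finite adeles. -/
theorem finiteAdele_mul_apply' (v : HeightOneSpectrum (𝓞 k)) (x y : FiniteAdeleRing (𝓞 k) k) :
    (x * y) v = x v * y v := rfl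

/-- The `v`-component of a difference of finite adeles. -/
theorem finiteAdele_sub_apply' (v : HeightOneSpectrum (𝓞 k)) (x y : FiniteAdeleRing (𝓞 k) k) :
    (x - y) v = x v - y v := rfl

/-- The `v`-component of a finite sum of finite adeles. -/
theorem finiteAdele_sum_apply' {ι : Type} (s : Finset ι) (f : ι → FiniteAdeleRing (𝓞 k) k)
    (v : HeightOneSpectrum (𝓞 k)) : (∑ i ∈ s, f i) v = ∑ i ∈ s, (f i) v := by
  classical
  induction s using Finset.induction_on with
  | empty => rfl
  | insert a s ha ih => rw [Finset.sum_insert ha, Finset.sum_insert ha, ← ih]; rfl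

/-- **Scaling by `N⁻¹` takes `modSet N` into the integral adeles.** -/
theorem natInv_mul_mem_integralSet {N : ℕ} (hN : N ≠ 0) {x : FiniteAdeleRing (𝓞 k) k} (hx : x ∈ modSet k N) :
    finPart k (algebraMap k (Ad k) ((N : k)⁻¹)) * x ∈ integralSet k := by
  intro v
  rw [HeightOneSpectrum.mem_adicCompletionIntegers, finiteAdele_mul_apply', Valuation.map_mul,
    finPart_algebraMap_apply, valued_algebraMap_natInv]
  have h0 : natSize k v N ≠ 0 := natSize_ne_zero k v hN
  calc (natSize k v N)⁻¹ * Valued.v (x v) ≤ (natSize k v N)⁻¹ * natSize k v N :=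
        mul_le_mul' (le_refl _) (hx v)
    _ = 1 := inv_mul_cancel₀ h0

/-- **Scaling back by `N`**: if `N⁻¹ x ∈ modSet D` then `x ∈ modSet (N D)`. -/
theorem mem_modSet_mul_of_natInv_mul_mem {N D : ℕ} (hN : N ≠ 0) {x : FiniteAdeleRing (𝓞 k) k}
    (hx : finPart k (algebraMap k (Ad k) ((N : k)⁻¹)) * x ∈ modSet k D) : x ∈ modSet k (N * D) := by
  intro v
  have hNk : (N : k) ≠ 0 := Nat.cast_ne_zero.2 hN
  have hx' : x = finPart k (algebraMap k (Ad k) (N : k)) * (finPart k (algebraMap k (Ad k) ((N : k)⁻¹)) * x) := by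
    rw [← mul_assoc, ← map_mul, ← map_mul, mul_inv_cancel₀ hNk, map_one, map_one, one_mul]
  have hv := hx v
  rw [hx', finiteAdele_mul_apply', Valuation.map_mul, finPart_algebraMap_apply, natSize_mul]
  exact mul_le_mul' (le_refl _) hv

/-- An integral adele times a congruence adele is a congruence adele. -/
theorem integral_mul_mem_modSet {N : ℕ} {x y : FiniteAdeleRing (𝓞 k) k} (hx : x ∈ integralSet k)
    (hy : y ∈ modSet k N) : x * y ∈ modSet k N := by
  intro v
  rw [finiteAdele_mul_apply', Valuation.map_mul]
  have h1 : Valued.v (x v) ≤ 1 := (HeightOneSpectrum.mem_adicCompletionIntegers (𝓞 k) k v).1 (hx v)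
  calc Valued.v (x v) * Valued.v (y v) ≤ 1 * natSize k v N := mul_le_mul' h1 (hy v)
    _ = natSize k v N := one_mul _

end Valuation

/-! ## 2. The integral box and its finite cover by congruence classes -/

section Box

variable {k : Type} [Field k] [NumberField k]

/-- The integral finite-adelic `4 × 4` matrices. -/
def finBox : Set (Matrix (Fin 4) (Fin 4) (FiniteAdeleRing (𝓞 k) k)) :=
  Set.pi Set.univ fun _ => Set.pi Set.univ fun _ => integralSet k

/-- `finBox` is compact (Tychonoff). -/
theorem isCompact_finBox : IsCompact (finBox (k := k)) :=
  isCompact_univ_pi fun _ => isCompact_univ_pi fun _ => isCompact_integralSet k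

/-- Membership in `finBox`, entrywise. -/
theorem mem_finBox {X : Matrix (Fin 4) (Fin 4) (FiniteAdeleRing (𝓞 k) k)} :
    X ∈ finBox ↔ ∀ i j, X i j ∈ integralSet k :=
  ⟨fun h i j => h i (Set.mem_univ _) j (Set.mem_univ _), fun h i _ j _ => h i j⟩

/-- The congruence classes mod `D`: the matrices with every entry in `modSet D`. -/
def finMod (D : ℕ) : Set (Matrix (Fin 4) (Fin 4) (FiniteAdeleRing (𝓞 k) k)) :=
  {X | ∀ i j, X i j ∈ modSet k D}

/-- `finMod D` is open (`D ≠ 0`). -/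
theorem isOpen_finMod {D : ℕ} (hD : D ≠ 0) : IsOpen (finMod (k := k) D) := by
  have h : finMod (k := k) D = ⋂ i, ⋂ j,
      (fun X : Matrix (Fin 4) (Fin 4) (FiniteAdeleRing (𝓞 k) k) => X i j) ⁻¹' modSet k D := by
    ext X
    simp only [finMod, Set.mem_setOf_eq, Set.mem_iInter, Set.mem_preimage]
  rw [h]
  exact isOpen_iInter_of_finite fun i => isOpen_iInter_of_finite fun j =>
    (isOpen_modSet k hD).preimage (continuous_apply_apply i j)

/-- `0 ∈ finMod D`. -/
theorem zero_mem_finMod (D : ℕ) : (0 : Matrix (Fin 4) (Fin 4) (FiniteAdeleRing (𝓞 k) k)) ∈ finMod D :=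
  fun _ _ => zero_mem_modSet k D

/-- `finMod D` is closed under differences. -/
theorem sub_mem_finMod {D : ℕ} {X Y : Matrix (Fin 4) (Fin 4) (FiniteAdeleRing (𝓞 k) k)} (hX : X ∈ finMod D)
    (hY : Y ∈ finMod D) : X - Y ∈ finMod D := fun i j => by
  rw [Matrix.sub_apply, sub_eq_add_neg]
  exact add_mem_modSet k (hX i j) (neg_mem_modSet k (hY i j))

/-- **The finite cover of the integral box by congruence classes** (`D ≠ 0`): finitely many `Y + finMod D` cover it. -/
theorem exists_finset_cover_finBox {D : ℕ} (hD : D ≠ 0) :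
    ∃ t : Finset (Matrix (Fin 4) (Fin 4) (FiniteAdeleRing (𝓞 k) k)),
      finBox ⊆ ⋃ Y ∈ t, (fun X : Matrix (Fin 4) (Fin 4) (FiniteAdeleRing (𝓞 k) k) => X - Y) ⁻¹' finMod D := by
  have hU : ∀ Y : Matrix (Fin 4) (Fin 4) (FiniteAdeleRing (𝓞 k) k),
      (fun X : Matrix (Fin 4) (Fin 4) (FiniteAdeleRing (𝓞 k) k) => X - Y) ⁻¹' finMod D ∈ 𝓝 Y := by
    intro Y
    have ho : IsOpen ((fun X : Matrix (Fin 4) (Fin 4) (FiniteAdeleRing (𝓞 k) k) => X - Y) ⁻¹' finMod D) :=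
      (isOpen_finMod hD).preimage (continuous_id.sub continuous_const)
    have h00 : (0 : Matrix (Fin 4) (Fin 4) (FiniteAdeleRing (𝓞 k) k)) ∈ finMod D := zero_mem_finMod D
    have h0 : Y - Y ∈ finMod D := by rwa [sub_self]
    exact ho.mem_nhds h0
  obtain ⟨t, -, ht⟩ := isCompact_finBox.elim_nhds_subcover
    (fun Y : Matrix (Fin 4) (Fin 4) (FiniteAdeleRing (𝓞 k) k) =>
      (fun X : Matrix (Fin 4) (Fin 4) (FiniteAdeleRing (𝓞 k) k) => X - Y) ⁻¹' finMod D) (fun Y _ => hU Y)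
  exact ⟨t, ht⟩

end Box

/-! ## 3. The scaled matrix of an element of `K(N)`, and the congruence of `g⁻¹ g′` -/

section Scaled

variable {k : Type} [Field k] [NumberField k]

/-- **The scaled matrix** `N⁻¹ · finPart (A − 1)` of an adelic matrix. -/
def scaled (N : ℕ) (A : M4 k) : Matrix (Fin 4) (Fin 4) (FiniteAdeleRing (𝓞 k) k) :=
  fun i j => finPart k (algebraMap k (Ad k) ((N : k)⁻¹)) * finPart k ((A - 1) i j)

/-- The scaled matrix of `A ≡ 1 (mod N)` is integral. -/
theorem scaled_mem_finBox {N : ℕ} (hN : N ≠ 0) {A : M4 k} (hA : IsCongr k N A) : scaled N A ∈ finBox :=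
  mem_finBox.2 fun i j => natInv_mul_mem_integralSet hN (hA i j).2

/-- If the scaled matrices of `A` and `B` are congruent mod `D`, then `finPart (B − A) ≡ 0 (mod N D)` entrywise. -/
theorem finPart_sub_mem_modSet_of_scaled {N D : ℕ} (hN : N ≠ 0) {A B : M4 k}
    (h : scaled N B - scaled N A ∈ finMod D) (i j : Fin 4) : finPart k ((B - A) i j) ∈ modSet k (N * D) := by
  refine mem_modSet_mul_of_natInv_mul_mem hN ?_
  have := h i j
  simp only [scaled, Matrix.sub_apply] at this
  rw [← mul_sub, ← map_sub] at this
  have hBA : B i j - (1 : M4 k) i j - (A i j - (1 : M4 k) i j) = (B - A) i j := by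
    rw [Matrix.sub_apply]
    ring
  rw [hBA] at this
  exact this

/-- **The congruence of a product**: `Binv` integral at the finite places, `B′ − B ≡ 0 (mod N D)` entrywise with
archimedean parts equal, and `Binv * B = 1` give `Binv * B′ ≡ 1 (mod N D)`. -/
theorem isCongr_mul_of_sub {N D : ℕ} {Binv B B' : M4 k} (hBB : Binv * B = 1)
    (hBinv : ∀ i j, finPart k (Binv i j) ∈ integralSet k)
    (hinf : ∀ i j, infPart k ((B' - B) i j) = 0)
    (hfin : ∀ i j, finPart k ((B' - B) i j) ∈ modSet k (N * D)) : IsCongr k (N * D) (Binv * B') := by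
  intro i j
  have hid : Binv * B' - 1 = Binv * (B' - B) := by rw [Matrix.mul_sub, hBB]
  rw [hid]
  have hentry : (Binv * (B' - B)) i j = ∑ a : Fin 4, Binv i a * (B' - B) a j := Matrix.mul_apply
  rw [hentry]
  refine ⟨?_, ?_⟩
  · rw [map_sum]
    refine Finset.sum_eq_zero fun a _ => ?_
    rw [map_mul, hinf a j, mul_zero]
  · rw [map_sum]
    refine sum_mem_modSet k Finset.univ fun a _ => ?_
    rw [map_mul]
    exact integral_mul_mem_modSet (hBinv i a) (hfin a j)

/-- The archimedean parts of the entries of two matrices `≡ 1 (mod N)` agree. -/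
theorem infPart_sub_eq_zero_of_isCongr {N : ℕ} {A B : M4 k} (hA : IsCongr k N A) (hB : IsCongr k N B)
    (i j : Fin 4) : infPart k ((B - A) i j) = 0 := by
  have h1 := (hA i j).1
  have h2 := (hB i j).1
  have h : (B - A) i j = (B - 1) i j - (A - 1) i j := by
    simp only [Matrix.sub_apply]
    ring
  rw [h, map_sub, h1, h2, sub_zero]

/-- The finite parts of the entries of a matrix `≡ 1 (mod N)` are integral. -/
theorem finPart_mem_integralSet_of_isCongr {N : ℕ} {A : M4 k} (hA : IsCongr k N A) (i j : Fin 4) :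
    finPart k (A i j) ∈ integralSet k := by
  have h := mem_integralBox_of_isCongr hA
  exact (h i (Set.mem_univ _) j (Set.mem_univ _)).2

variable (W : PlaneData k)

/-- **Same class ⇒ same coset**: `g, g′ ∈ K(N)` with congruent scaled matrices mod `D` have `g⁻¹ g′ ∈ K(N D)`. -/
theorem inv_mul_mem_levelK_mul_of_scaled {N D : ℕ} (hN : N ≠ 0) {g g' : GA W} (hg : g ∈ levelK W N)
    (hg' : g' ∈ levelK W N) (h : scaled N (GA.mat W g') - scaled N (GA.mat W g) ∈ finMod D) :
    g⁻¹ * g' ∈ levelK W (N * D) := by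
  rw [mem_levelK] at hg hg' ⊢
  have hsub : ∀ i j, finPart k ((GA.mat W g' - GA.mat W g) i j) ∈ modSet k (N * D) :=
    finPart_sub_mem_modSet_of_scaled hN h
  have hsub' : ∀ i j, finPart k ((GA.mat W g - GA.mat W g') i j) ∈ modSet k (N * D) := by
    intro i j
    have : (GA.mat W g - GA.mat W g') i j = -((GA.mat W g' - GA.mat W g) i j) := by
      simp only [Matrix.sub_apply]
      ring
    rw [this, map_neg]
    exact neg_mem_modSet k (hsub i j)
  refine ⟨?_, ?_⟩
  · rw [GA.mat_mul]
    exact isCongr_mul_of_sub (GA.mat_inv_mul W g) (finPart_mem_integralSet_of_isCongr hg.2)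
      (infPart_sub_eq_zero_of_isCongr hg.1 hg'.1) hsub
  · rw [mul_inv_rev, inv_inv, GA.mat_mul]
    exact isCongr_mul_of_sub (GA.mat_inv_mul W g') (finPart_mem_integralSet_of_isCongr hg'.2)
      (infPart_sub_eq_zero_of_isCongr hg'.1 hg.1) hsub'

end Scaled

/-! ## 4. THE COVER: `K(N) ⊆ ⋃_{≤ M(D)} g K(N D)`, uniformly in `N` -/

section Cover

variable {k : Type} [Field k] [NumberField k] (W : PlaneData k)

/-- **P3, the cover form**: for every modulus `D ≠ 0` there is `M` such that for EVERY level `N ≠ 0`, `K(N)` is covered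
by at most `M` left translates `g K(N D)` with `g ∈ K(N)`. -/
theorem exists_finset_cover_levelK_mul (D : ℕ) (hD : D ≠ 0) :
    ∃ M : ℕ, ∀ N : ℕ, N ≠ 0 → ∃ reps : Finset (GA W), (∀ g ∈ reps, g ∈ levelK W N) ∧ reps.card ≤ M ∧
      (levelK W N : Set (GA W)) ⊆ ⋃ g ∈ reps, g • (levelK W (N * D) : Set (GA W)) := by
  classical
  obtain ⟨t, ht⟩ := exists_finset_cover_finBox (k := k) hD
  refine ⟨t.card, fun N hN => ?_⟩
  -- the class of `Y` inside `K(N)`, and a representative of each non-empty class (opaque, by `obtain`)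
  obtain ⟨cls, hcls⟩ : ∃ cls : Matrix (Fin 4) (Fin 4) (FiniteAdeleRing (𝓞 k) k) → Set (GA W),
      ∀ Y g, g ∈ cls Y ↔ g ∈ levelK W N ∧ scaled N (GA.mat W g) - Y ∈ finMod D :=
    ⟨fun Y => {g | g ∈ levelK W N ∧ scaled N (GA.mat W g) - Y ∈ finMod D}, fun _ _ => Iff.rfl⟩
  obtain ⟨pick, hpick⟩ : ∃ pick : Matrix (Fin 4) (Fin 4) (FiniteAdeleRing (𝓞 k) k) → GA W,
      ∀ Y, (cls Y).Nonempty → pick Y ∈ cls Y :=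
    ⟨fun Y => if h : (cls Y).Nonempty then h.choose else 1, fun Y h => by simp only [dif_pos h]; exact h.choose_spec⟩
  refine ⟨(t.filter fun Y => (cls Y).Nonempty).image pick, ?_, ?_, ?_⟩
  · intro g hg
    obtain ⟨Y, hY, rfl⟩ := Finset.mem_image.1 hg
    exact ((hcls Y _).1 (hpick Y (Finset.mem_filter.1 hY).2)).1
  · exact Finset.card_image_le.trans (Finset.card_filter_le _ _)
  · intro g hg
    have hgK : g ∈ levelK W N := hg
    have hgb : scaled N (GA.mat W g) ∈ finBox := scaled_mem_finBox hN ((mem_levelK W N g).1 hgK).1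
    obtain ⟨Y, hYt, hYg⟩ := Set.mem_iUnion₂.1 (ht hgb)
    have hYg' : scaled N (GA.mat W g) - Y ∈ finMod D := hYg
    have hne : (cls Y).Nonempty := ⟨g, (hcls Y g).2 ⟨hgK, hYg'⟩⟩
    refine Set.mem_iUnion₂.2 ⟨pick Y, Finset.mem_image_of_mem _ (Finset.mem_filter.2 ⟨hYt, hne⟩), ?_⟩
    rw [Set.mem_smul_set_iff_inv_smul_mem]
    obtain ⟨hpK, hpY⟩ := (hcls Y _).1 (hpick Y hne)
    have hdiff : scaled N (GA.mat W g) - scaled N (GA.mat W (pick Y)) ∈ finMod D := by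
      have := sub_mem_finMod hYg' hpY
      rwa [sub_sub_sub_cancel_right] at this
    exact inv_mul_mem_levelK_mul_of_scaled W hN hpK hgK hdiff

/-- **P3 on a subgroup `H`** (the torus: `H ⊓ K(N) = T_f ∩ K(N)`): `H ⊓ K(N)` is covered by at most `M` translates
`h (H ⊓ K(N D))`, `h ∈ H ⊓ K(N)`, with the same `M = M(D)` for every `N ≠ 0`. -/
theorem exists_finset_cover_inf_levelK_mul (H : Subgroup (GA W)) (D : ℕ) (hD : D ≠ 0) :
    ∃ M : ℕ, ∀ N : ℕ, N ≠ 0 → ∃ reps : Finset (GA W), (∀ g ∈ reps, g ∈ H ⊓ levelK W N) ∧ reps.card ≤ M ∧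
      ((H ⊓ levelK W N : Subgroup (GA W)) : Set (GA W)) ⊆
        ⋃ g ∈ reps, g • ((H ⊓ levelK W (N * D) : Subgroup (GA W)) : Set (GA W)) := by
  classical
  obtain ⟨M, hM⟩ := exists_finset_cover_levelK_mul W D hD
  refine ⟨M, fun N hN => ?_⟩
  obtain ⟨reps, hrepsK, hcard, hcover⟩ := hM N hN
  obtain ⟨meet, hmeet⟩ : ∃ meet : GA W → Set (GA W), ∀ g x, x ∈ meet g ↔
      x ∈ g • (levelK W (N * D) : Set (GA W)) ∧ x ∈ H ⊓ levelK W N :=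
    ⟨fun g => (g • (levelK W (N * D) : Set (GA W))) ∩ (H ⊓ levelK W N : Subgroup (GA W)), fun _ _ => Iff.rfl⟩
  obtain ⟨pick, hpick⟩ : ∃ pick : GA W → GA W, ∀ g, (meet g).Nonempty → pick g ∈ meet g :=
    ⟨fun g => if h : (meet g).Nonempty then h.choose else 1, fun g h => by simp only [dif_pos h]; exact h.choose_spec⟩
  refine ⟨(reps.filter fun g => (meet g).Nonempty).image pick, ?_, ?_, ?_⟩
  · intro h hh
    obtain ⟨g, hg, rfl⟩ := Finset.mem_image.1 hh
    exact ((hmeet g _).1 (hpick g (Finset.mem_filter.1 hg).2)).2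
  · exact Finset.card_image_le.trans ((Finset.card_filter_le _ _).trans hcard)
  · intro x hx
    have hxH : x ∈ H ⊓ levelK W N := hx
    obtain ⟨g, hg, hxg⟩ := Set.mem_iUnion₂.1 (hcover hxH.2)
    have hne : (meet g).Nonempty := ⟨x, (hmeet g x).2 ⟨hxg, hxH⟩⟩
    refine Set.mem_iUnion₂.2 ⟨pick g, Finset.mem_image_of_mem _ (Finset.mem_filter.2 ⟨hg, hne⟩), ?_⟩
    obtain ⟨hpg, hpH⟩ := (hmeet g _).1 (hpick g hne)
    rw [Set.mem_smul_set_iff_inv_smul_mem] at hxg hpg ⊢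
    show (pick g)⁻¹ * x ∈ H ⊓ levelK W (N * D)
    have hpH' : pick g ∈ H ⊓ levelK W N := hpH
    refine ⟨H.mul_mem (H.inv_mem hpH'.1) hxH.1, ?_⟩
    have h1 : (pick g)⁻¹ * x = (g⁻¹ * pick g)⁻¹ * (g⁻¹ * x) := by group
    rw [h1]
    exact (levelK W (N * D)).mul_mem ((levelK W (N * D)).inv_mem hpg) hxg

/-- **P3, the index form**: `[H ⊓ K(N) : H ⊓ K(N D)] ≤ M(D)` for every `N ≠ 0` (`Subgroup.relIndex K H = [H : H ⊓ K]`). -/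
theorem relIndex_inf_levelK_mul_le (H : Subgroup (GA W)) (D : ℕ) (hD : D ≠ 0) :
    ∃ M : ℕ, ∀ N : ℕ, N ≠ 0 → (H ⊓ levelK W (N * D)).relIndex (H ⊓ levelK W N) ≤ M := by
  classical
  obtain ⟨M, hM⟩ := exists_finset_cover_inf_levelK_mul W H D hD
  refine ⟨M, fun N hN => ?_⟩
  obtain ⟨reps, hrepsK, hcard, hcover⟩ := hM N hN
  set HN : Subgroup (GA W) := H ⊓ levelK W N with hHN
  set HND : Subgroup (GA W) := H ⊓ levelK W (N * D) with hHND
  -- the representatives, as elements of `HN`, surject onto the quotient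
  let f : {g : GA W // g ∈ reps} → HN ⧸ HND.subgroupOf HN :=
    fun g => QuotientGroup.mk ⟨g.1, hrepsK g.1 g.2⟩
  have hf : Function.Surjective f := by
    intro q
    induction q using QuotientGroup.induction_on with
    | H x =>
      obtain ⟨g, hg, hxg⟩ := Set.mem_iUnion₂.1 (hcover x.2)
      refine ⟨⟨g, hg⟩, ?_⟩
      show QuotientGroup.mk (⟨g, hrepsK g hg⟩ : HN) = QuotientGroup.mk x
      rw [QuotientGroup.eq]
      rw [Set.mem_smul_set_iff_inv_smul_mem] at hxg
      exact hxg
  have h1 : (H ⊓ levelK W (N * D)).relIndex (H ⊓ levelK W N) = Nat.card (HN ⧸ HND.subgroupOf HN) := rfl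
  rw [h1]
  calc Nat.card (HN ⧸ HND.subgroupOf HN) ≤ Nat.card {g : GA W // g ∈ reps} := Nat.card_le_card_of_surjective f hf
    _ = reps.card := by rw [Nat.card_eq_fintype_card, Fintype.card_coe]
    _ ≤ M := hcard

end Cover

end Summit.Ventures.HodgeRepro.Tier4.Line4

end
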